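import Literature.NumberTheory.EllipticCurves.NeronComponentIndexTypeInstarProofs
import Summits.BirchSwinnertonDyer.BirchSwinnertonDyer.Theorems.Rank2ObservatoryTamagawaExactLocal
import HarnessLib

/-!
# BSD rank ≥ 2 observatory (`b2b-bsdr2`, cert-2 gen 11): EXACT local Tamagawa numbers for the
# Kodaira types `Iₙ*` (`n ≥ 1`) — part 1: the component group is `ℤ/4` or `(ℤ/2)²` iff a point of
# "side `D`" exists, `ℤ/2` iff not

HONEST FRAMING: per-curve certified theorems and census instruments; no claim on BSD in rank ≥ 2.

Theorems only (no named fact, no axiom).  Over a Henselian discrete valuation ring `R` (fraction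
field `K`, uniformizer `π`) let `J` be in the normal form of Tate's Step 7 — `a₁ ∈ 𝔪`, `π ∥ a₂`,
`π² ∣ a₃`, `π³ ∣ a₄`, `π⁴ ∣ a₆`, `Δ ≠ 0` (type `Iₙ*`, `n ≥ 1`, when minimal).  The tree proves
`[E(K) : E₀(K)] ∈ {2, 4}` (`LocalIndex.index_mem_of_normalForm_Istar_succ`, Silverman *ATAEC* IV.9.4
Step 7): a point with singular reduction is `(πx₁, π²y₂)` with `x̄₁ = −ā₂,₁` (side `S`, one class `s`
of order `2`) or `x̄₁ = 0` (side `D`).  This file decides WHICH: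
* `not_hasNonsingularReduction_add_of_residue_ne` (the new lever, for `a₁, …, a₆ ∈ 𝔪`): two points
  `(πx₁, π²y₂)`, `(πx₁', π²y₂')` with `x̄₁ ≠ x̄₁'` add up to a point WITH SINGULAR reduction — the
  chord has slope `π(y₂ − y₂')/(x₁ − x₁') ∈ 𝔪`, so `x(P + P') = λ² + a₁λ − a₂ − πx₁ − πx₁' ∈ 𝔪`;
* `index_eq_four_of_sideD`: if some `K`-point `(πx₁, π²y₂)` has `x₁ ∈ 𝔪` then the index is `4`
  (were it `2`, the classes of that point, of a side-`S` point `(πt, 0)` — `t` a Hensel root of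
  `T³ + a₂,₁T² + a₄,₂T + a₆,₃` near `−a₂,₁`, as in the tree — and of their sum would all be the
  non-trivial coset, forcing the side-`S` point into `E₀(K)`);
* `index_eq_two_of_no_sideD`: if no `K`-point `(πx₁, π²y₂)` has `x₁ ∈ 𝔪`, every bad point is of
  side `S`, two of them add into `E₀(K)` (`LocalIndex.hasNonsingularReduction_add_of_same_root`), and
  `E₀(K) ≠ E(K)` (index `≠ 1`), so the index is `2` (`LocalIndex.index_eq_two_of_forall_add_mem`);
* `pow_succ_dvd_of_dvd_mul_add` and `uniformizer_dvd_of_equation` ("valuation climbing"): the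
  divisibility bookkeeping that part 2 (`Rank2ObservatoryTamagawaIstarLevel`) uses to read the
  existence of a side-`D` point off the quadratic of the LAST round of Tate's sub-procedure.
In Tate's language (Silverman *ATAEC* IV.9.4 Step 7, Table 4.1): `c = 4` iff the separable quadratic
of the round that exits has its roots in the residue field; parts 2–3 make this a kernel certificate.
References: J. Tate, *Algorithm for determining the type of a singular fiber in an elliptic pencil*,
LNM 476 (1975) §7 [Tate1975]; J. H. Silverman, *Advanced Topics in the Arithmetic of Elliptic Curves*,
GTM 151 (1994), IV.9.4 Step 7 and Table 4.1 [Silverman1994] [SilvermanATAEC1994].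
-/

set_option linter.dupNamespace false
set_option autoImplicit false

noncomputable section

open scoped Classical

open Polynomial IsLocalRing WeierstrassCurve
  Literature.NumberTheory.EllipticCurves Literature.NumberTheory.EllipticCurves.LocalIndex
  Literature.NumberTheory.DiophantineGeometry Literature.NumberTheory.DiophantineGeometry.TateAlgorithm

namespace Summit.BirchSwinnertonDyer.BirchSwinnertonDyer.Rank2Observatory.Tam

section Local

variable {R : Type*} [CommRing R] [IsDomain R] [IsDiscreteValuationRing R]
  {K : Type*} [Field K] [Algebra R K] [IsFractionRing R K]

/-! ### Two bad points over different residues add up to a bad point -/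

/-- **Two points over different residues of `x/π` add up OUTSIDE `E₀(K)`** (`a₁, …, a₆ ∈ 𝔪`): for
`P = (πx₁, π²y₂)`, `P' = (πx₁', π²y₂')` with `x̄₁ ≠ x̄₁'` the chord slope is
`λ = π(y₂ − y₂')/(x₁ − x₁') ∈ 𝔪` (`x₁ − x₁'` is a unit), so `x(P + P') = λ² + a₁λ − a₂ − πx₁ − πx₁'`
lies in `𝔪` and `P + P'` reduces to the singular point `(0, 0)`
(`LocalIndex.not_hasNonsingularReduction_of_X_mem`).  This separates the classes of `E(K)/E₀(K)` over
different roots of Tate's cubic (types `I₀*`, `Iₙ*`); `a₁` is not needed in `𝔪`.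
[cite: Silverman1994, IV.9.4 Steps 6–7] -/
theorem not_hasNonsingularReduction_add_of_residue_ne (J : WeierstrassCurve R) {ϖ : R}
    (hϖ : Irreducible ϖ) (h2 : J.a₂ ∈ maximalIdeal R) (h3 : J.a₃ ∈ maximalIdeal R) (h4 : J.a₄ ∈ maximalIdeal R) (h6 : J.a₆ ∈ maximalIdeal R)
    {x₁ y₂ x₁' y₂' : R} (hne : residue R x₁ ≠ residue R x₁')
    (h₁ : (J.baseChange K).toAffine.Nonsingular (algebraMap R K (ϖ * x₁))
      (algebraMap R K (ϖ ^ 2 * y₂)))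
    (h₂ : (J.baseChange K).toAffine.Nonsingular (algebraMap R K (ϖ * x₁'))
      (algebraMap R K (ϖ ^ 2 * y₂'))) :
    ¬ J.HasNonsingularReduction
      (WeierstrassCurve.Affine.Point.some _ _ h₁ + WeierstrassCurve.Affine.Point.some _ _ h₂) := by
  have hinj := IsFractionRing.injective R K
  set f := algebraMap R K with hf
  have hm : ϖ ∈ maximalIdeal R := (IsLocalRing.mem_maximalIdeal _).mpr hϖ.not_isUnit
  have hu : IsUnit (x₁ - x₁') := by
    rw [isUnit_iff_residue_ne_zero, map_sub, sub_ne_zero]; exact hne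
  have hx : f (ϖ * x₁) ≠ f (ϖ * x₁') := fun h =>
    hu.ne_zero (sub_eq_zero.mpr (mul_left_cancel₀ hϖ.ne_zero (hinj h)))
  have hxy : ¬ (f (ϖ * x₁) = f (ϖ * x₁') ∧
      f (ϖ ^ 2 * y₂) = (J.baseChange K).toAffine.negY (f (ϖ * x₁')) (f (ϖ ^ 2 * y₂'))) :=
    fun h => hx h.1
  rw [WeierstrassCurve.Affine.Point.add_some hxy]
  set ℓ₁ : R := (y₂ - y₂') * ↑hu.unit⁻¹ with hℓ₁
  have hL : (J.baseChange K).toAffine.slope (f (ϖ * x₁)) (f (ϖ * x₁')) (f (ϖ ^ 2 * y₂))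
      (f (ϖ ^ 2 * y₂')) = f (ϖ * ℓ₁) := by
    rw [WeierstrassCurve.Affine.slope_of_X_ne hx, div_eq_iff (sub_ne_zero.mpr hx), ← map_sub,
      ← map_sub, ← map_mul]
    congr 1
    have e : ϖ * ℓ₁ * (ϖ * x₁ - ϖ * x₁') =
        ϖ ^ 2 * (y₂ - y₂') * ((x₁ - x₁') * ↑hu.unit⁻¹) := by rw [hℓ₁]; ring
    rw [e, IsUnit.mul_val_inv, mul_one]; ring
  have hX : (J.baseChange K).toAffine.addX (f (ϖ * x₁)) (f (ϖ * x₁'))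
      ((J.baseChange K).toAffine.slope (f (ϖ * x₁)) (f (ϖ * x₁')) (f (ϖ ^ 2 * y₂))
        (f (ϖ ^ 2 * y₂'))) =
      f ((ϖ * ℓ₁) ^ 2 + J.a₁ * (ϖ * ℓ₁) - J.a₂ - ϖ * x₁ - ϖ * x₁') := by
    rw [WeierstrassCurve.Affine.addX, hL]; simp [WeierstrassCurve.baseChange, ← hf]
  refine not_hasNonsingularReduction_of_X_mem J h3 h4 h6 ?_ _ hX
  exact Ideal.sub_mem _ (Ideal.sub_mem _ (Ideal.sub_mem _ (Ideal.add_mem _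
    (Ideal.pow_mem_of_mem _ (Ideal.mul_mem_right _ _ hm) 2 two_pos)
    (Ideal.mul_mem_left _ _ (Ideal.mul_mem_right _ _ hm))) h2) (Ideal.mul_mem_right _ _ hm))
    (Ideal.mul_mem_right _ _ hm)

/-! ### Divisibility bookkeeping ("valuation climbing") -/

/-- If `π^{j+1} ∣ c` and `π^{2j+1} ∣ y (y + c)` then `π^{j+1} ∣ y`: otherwise `y = u πᵐ` with
`m ≤ j`, `y + c = πᵐ · unit`, and `π^{2j+1} ∣ π^{2m}`. [folklore] -/
theorem pow_succ_dvd_of_dvd_mul_add {ϖ : R} (hϖ : Irreducible ϖ) (j : ℕ) {y c : R}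
    (hc : ϖ ^ (j + 1) ∣ c) (h : ϖ ^ (2 * j + 1) ∣ y * (y + c)) : ϖ ^ (j + 1) ∣ y := by
  by_cases hy0 : y = 0
  · rw [hy0]; exact dvd_zero _
  obtain ⟨m, u, hy⟩ := IsDiscreteValuationRing.eq_unit_mul_pow_irreducible hy0 hϖ
  by_cases hmj : j + 1 ≤ m
  · rw [hy]; exact Dvd.dvd.mul_left (pow_dvd_pow ϖ hmj) _
  exfalso
  obtain ⟨c', hc'⟩ := hc
  obtain ⟨i, hi⟩ : ∃ i, j = m + i := ⟨j - m, by omega⟩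
  have e : y * (y + c) = ϖ ^ (2 * m) * ((u : R) * ((u : R) + ϖ * (ϖ ^ i * c'))) := by
    rw [hc', hy, hi]; ring
  rw [e] at h
  have hunit : IsUnit ((u : R) * ((u : R) + ϖ * (ϖ ^ i * c'))) :=
    u.isUnit.mul (isUnit_add_mul_of_isUnit hϖ u.isUnit _)
  have h' : ϖ ^ (2 * j + 1) ∣ ϖ ^ (2 * m) := hunit.dvd_mul_right.mp h
  rw [pow_dvd_pow_iff hϖ.ne_zero hϖ.not_isUnit] at h'
  omega

/-- **One climbing step.** In the normal form `π ∣ a₁`, `a₂ = πp` (`p ∈ Rˣ`), `π^{j+1} ∣ a₃`,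
`π^{j+2} ∣ a₄`, `π^{2j+2} ∣ a₆` with `j ≥ 2`, an `R`-point `(πʲX, y)` has `π ∣ X`: the equation reads
`y(y + a₁x + a₃) = π^{2j+1}(pX² + π·(…))`, so `π^{j+1} ∣ y` (`pow_succ_dvd_of_dvd_mul_add`), the left
side is divisible by `π^{2j+2}`, and `π ∣ pX²`. [cite: Silverman1994, IV.9.4 Step 7] -/
theorem uniformizer_dvd_of_equation (J : WeierstrassCurve R) {ϖ : R} (hϖ : Irreducible ϖ)
    (i : ℕ) (h1 : ϖ ∣ J.a₁) {p : R} (hp : J.a₂ = ϖ * p) (hpu : IsUnit p)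
    (h3 : ϖ ^ (i + 3) ∣ J.a₃) (h4 : ϖ ^ (i + 4) ∣ J.a₄) (h6 : ϖ ^ (2 * i + 6) ∣ J.a₆) {X y : R}
    (heq : J.toAffine.Equation (ϖ ^ (i + 2) * X) y) : ϖ ∣ X := by
  rw [WeierstrassCurve.Affine.equation_iff] at heq
  obtain ⟨α, hα⟩ := h1
  obtain ⟨A₃, hA₃⟩ := h3
  obtain ⟨A₄, hA₄⟩ := h4
  obtain ⟨A₆, hA₆⟩ := h6
  have hc : ϖ ^ (i + 2 + 1) ∣ J.a₁ * (ϖ ^ (i + 2) * X) + J.a₃ := by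
    rw [hα, hA₃]; exact ⟨α * X + A₃, by ring⟩
  have hprod : y * (y + (J.a₁ * (ϖ ^ (i + 2) * X) + J.a₃)) =
      ϖ ^ (2 * (i + 2) + 1) * (p * X ^ 2 + ϖ * (ϖ ^ i * X ^ 3 + A₄ * X + A₆)) := by
    have e : y * (y + (J.a₁ * (ϖ ^ (i + 2) * X) + J.a₃)) =
        (ϖ ^ (i + 2) * X) ^ 3 + J.a₂ * (ϖ ^ (i + 2) * X) ^ 2 + J.a₄ * (ϖ ^ (i + 2) * X) + J.a₆ := by
      linear_combination heq
    rw [e, hp, hA₄, hA₆]; ring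
  have hy : ϖ ^ (i + 2 + 1) ∣ y :=
    pow_succ_dvd_of_dvd_mul_add hϖ (i + 2) hc (hprod ▸ Dvd.intro _ rfl)
  obtain ⟨y', hy'⟩ := hy
  obtain ⟨c', hc'⟩ := hc
  have e1 : y * (y + (J.a₁ * (ϖ ^ (i + 2) * X) + J.a₃)) =
      ϖ ^ (2 * (i + 2) + 1) * (ϖ * (y' * (y' + c'))) := by
    rw [hc', hy']; ring
  have key : ϖ ^ (2 * (i + 2) + 1) * (p * X ^ 2) =
      ϖ ^ (2 * (i + 2) + 1) * (ϖ * (y' * (y' + c') - (ϖ ^ i * X ^ 3 + A₄ * X + A₆))) := by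
    linear_combination hprod.symm.trans e1
  have hX2 : ϖ ∣ p * X ^ 2 := ⟨_, mul_left_cancel₀ (pow_ne_zero _ hϖ.ne_zero) key⟩
  exact hϖ.prime.dvd_of_dvd_pow (hpu.dvd_mul_left.mp hX2)

/-- **Climbing**: in the normal form `π ∣ a₁`, `a₂ = πp` (`p ∈ Rˣ`), `π^{m+2} ∣ a₃`, `π^{m+3} ∣ a₄`,
`π^{2m+4} ∣ a₆`, an `R`-point `(x, y)` with `π² ∣ x` has `π^{i+2} ∣ x` for every `i ≤ m`.
[cite: Silverman1994, IV.9.4 Step 7] -/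
theorem pow_dvd_X_of_equation (J : WeierstrassCurve R) {ϖ : R} (hϖ : Irreducible ϖ) {m : ℕ}
    (h1 : ϖ ∣ J.a₁) {p : R} (hp : J.a₂ = ϖ * p) (hpu : IsUnit p) (h3 : ϖ ^ (m + 2) ∣ J.a₃)
    (h4 : ϖ ^ (m + 3) ∣ J.a₄) (h6 : ϖ ^ (2 * m + 4) ∣ J.a₆) {x y : R} (hx : ϖ ^ 2 ∣ x)
    (heq : J.toAffine.Equation x y) : ∀ i : ℕ, i ≤ m → ϖ ^ (i + 2) ∣ x
  | 0, _ => hx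
  | i + 1, hi => by
    obtain ⟨X, rfl⟩ := pow_dvd_X_of_equation J hϖ h1 hp hpu h3 h4 h6 hx heq i (by omega)
    show ϖ ^ (i + 2 + 1) ∣ ϖ ^ (i + 2) * X
    rw [pow_succ]
    refine mul_dvd_mul_left _ (uniformizer_dvd_of_equation J hϖ i h1 hp hpu ?_ ?_ ?_ heq)
    · exact (pow_dvd_pow ϖ (by omega)).trans h3
    · exact (pow_dvd_pow ϖ (by omega)).trans h4
    · exact (pow_dvd_pow ϖ (by omega)).trans h6

/-! ### The index for the normal form of type `Iₙ*`: `4` with a point of side `D`, `2` without -/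

/-- A point of side `S` exists: `(πt, 0)` with `t` a Hensel root of `T³ + pT² + πqT + πw` near `−p`
(the tree's construction in `index_mem_of_normalForm_Istar_succ`, isolated). [cite: Silverman1994, IV.9.4 Step 7] -/
theorem exists_sideS_point [HenselianLocalRing R] {ϖ p q w : R} (hϖ : Irreducible ϖ)
    (hpu : IsUnit p) :
    ∃ t : R, t ^ 3 + p * t ^ 2 + ϖ * q * t + ϖ * w = 0 ∧ residue R t = -residue R p := by
  have hm : ϖ ∈ maximalIdeal R := (IsLocalRing.mem_maximalIdeal _).mpr hϖ.not_isUnit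
  set g : R[X] := X ^ 3 + C p * X ^ 2 + C (ϖ * q) * X + C (ϖ * w) with hg
  have hmonic : g.Monic := by rw [hg]; monicity!
  have hev : ∀ x, g.eval x = x ^ 3 + p * x ^ 2 + ϖ * q * x + ϖ * w := by
    intro x; simp [hg]
  have hev' : ∀ x, g.derivative.eval x = 3 * x ^ 2 + 2 * p * x + ϖ * q := by
    intro x; simp [hg]; ring
  have h₁ : g.eval (-p) ∈ maximalIdeal R := by
    rw [hev]
    have e : (-p) ^ 3 + p * (-p) ^ 2 + ϖ * q * -p + ϖ * w = ϖ * (w - q * p) := by ring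
    rw [e]; exact Ideal.mul_mem_right _ _ hm
  have h₂ : IsUnit (g.derivative.eval (-p)) := by
    rw [hev']
    have e : 3 * (-p) ^ 2 + 2 * p * -p + ϖ * q = p ^ 2 + ϖ * q := by ring
    rw [e]; exact isUnit_add_mul_of_isUnit hϖ (hpu.pow 2) q
  obtain ⟨t, ht, ht₀⟩ := HenselianLocalRing.is_henselian g hmonic (-p) h₁ h₂
  refine ⟨t, by rw [← hev]; exact ht, ?_⟩
  have := (residue_eq_zero_iff _).mpr ht₀
  rwa [map_sub, map_neg, sub_eq_zero] at this

/-- The parameters of the `Iₙ*` normal form: `a₁ = πα`, `a₂ = πp` with `p ∈ Rˣ`, `a₃ = π²γ`,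
`a₄ = π²(πq)`, `a₆ = π³(πw)`. [folklore] -/
theorem normalForm_Istar_params (J : WeierstrassCurve R) (h1 : J.a₁ ∈ maximalIdeal R)
    (h2 : J.a₂ ∈ maximalIdeal R) (h2' : J.a₂ ∉ maximalIdeal R ^ 2)
    (h3 : J.a₃ ∈ maximalIdeal R ^ 2) (h4 : J.a₄ ∈ maximalIdeal R ^ 3)
    (h6 : J.a₆ ∈ maximalIdeal R ^ 4) :
    ∃ α p γ q w : R, J.a₁ = uniformizer R * α ∧ J.a₂ = uniformizer R * p ∧ IsUnit p ∧
      J.a₃ = uniformizer R ^ 2 * γ ∧ J.a₄ = uniformizer R ^ 2 * (uniformizer R * q) ∧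
      J.a₆ = uniformizer R ^ 3 * (uniformizer R * w) := by
  obtain ⟨α, hα⟩ := mem_maximalIdeal_iff_dvd.mp h1
  obtain ⟨p, hp⟩ := mem_maximalIdeal_iff_dvd.mp h2
  have hpu : IsUnit p := by
    refine IsLocalRing.notMem_maximalIdeal.mp fun hpm => h2' ?_
    rw [mem_maximalIdeal_pow_iff_dvd, hp, pow_two]
    exact mul_dvd_mul_left _ (mem_maximalIdeal_iff_dvd.mp hpm)
  obtain ⟨γ, hγ⟩ := mem_maximalIdeal_pow_iff_dvd.mp h3
  obtain ⟨q, hq⟩ := mem_maximalIdeal_pow_iff_dvd.mp h4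
  obtain ⟨w, hw⟩ := mem_maximalIdeal_pow_iff_dvd.mp h6
  exact ⟨α, p, γ, q, w, hα, hp, hpu, hγ, by rw [hq]; ring, by rw [hw]; ring⟩

/-- **A point of side `D` forces `[E(K) : E₀(K)] = 4`** (normal form of type `Iₙ*`, `n ≥ 1`, `R`
Henselian): given a `K`-point `P₁ = (πx₁, π²y₂)` with `x₁ ∈ 𝔪`, if the index were `2` then `P₁`, a
side-`S` point `P₀ = (πt, 0)` and `P₁ + P₀` (bad, `not_hasNonsingularReduction_add_of_residue_ne`) would
all lie in the non-trivial coset, whence `P₀ ∈ E₀(K)` — absurd; the tree's dichotomy leaves `4`.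
[cite: Tate1975, §7] [cite: Silverman1994, IV.9.4 Step 7] -/
theorem index_eq_four_of_sideD [HenselianLocalRing R] (J : WeierstrassCurve R) (hΔ : J.Δ ≠ 0)
    (h1 : J.a₁ ∈ maximalIdeal R) (h2 : J.a₂ ∈ maximalIdeal R) (h2' : J.a₂ ∉ maximalIdeal R ^ 2)
    (h3 : J.a₃ ∈ maximalIdeal R ^ 2) (h4 : J.a₄ ∈ maximalIdeal R ^ 3)
    (h6 : J.a₆ ∈ maximalIdeal R ^ 4) {x₁ y₂ : R} (hx₁ : x₁ ∈ maximalIdeal R)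
    (heq : J.toAffine.Equation (uniformizer R * x₁) (uniformizer R ^ 2 * y₂)) :
    (J.nonsingularReductionSubgroup (integers_valuationRing_valuation R K)).index = 4 := by
  have hϖ : Irreducible (uniformizer R) := irreducible_uniformizer
  set ϖ := uniformizer R with hϖdef
  set H := J.nonsingularReductionSubgroup (integers_valuationRing_valuation R K) with hH
  have hinj := IsFractionRing.injective R K
  have hm : ϖ ∈ maximalIdeal R := (IsLocalRing.mem_maximalIdeal _).mpr hϖ.not_isUnit
  obtain ⟨α, p, γ, q, w, hα, hp, hpu, hγ, hδ, hε⟩ := normalForm_Istar_params J h1 h2 h2' h3 h4 h6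
  rw [← hϖdef] at hα hp hγ hδ hε
  have hpres : residue R p ≠ 0 := (isUnit_iff_residue_ne_zero p).mp hpu
  have h3' := Ideal.pow_le_self two_ne_zero h3
  have h4' := Ideal.pow_le_self three_ne_zero h4
  have h6' := Ideal.pow_le_self four_ne_zero h6
  have hΔK : (J.baseChange K).Δ ≠ 0 := by
    rw [WeierstrassCurve.baseChange, WeierstrassCurve.map_Δ]; exact (map_ne_zero_iff _ hinj).mpr hΔ
  -- the given point of side `D`
  have hns₁ := (WeierstrassCurve.Affine.equation_iff_nonsingular_of_Δ_ne_zero hΔK).mp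
    ((WeierstrassCurve.Affine.map_equation _ hinj (ϖ * x₁) (ϖ ^ 2 * y₂)).mpr heq)
  set P₁ : (J.baseChange K).toAffine.Point := .some _ _ hns₁ with hP₁
  have hP₁H : P₁ ∉ H := fun h => not_hasNonsingularReduction_of_X_mem J h3' h4' h6'
    (Ideal.mul_mem_right _ _ hm) hns₁ rfl ((WeierstrassCurve.mem_nonsingularReductionSubgroup_iff _).mp h)
  -- a point of side `S`
  obtain ⟨t, ht, htres⟩ := exists_sideS_point (q := q) (w := w) hϖ hpu
  have hns₀ := (WeierstrassCurve.Affine.equation_iff_nonsingular_of_Δ_ne_zero hΔK).mp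
    ((WeierstrassCurve.Affine.map_equation _ hinj (ϖ * t) (ϖ ^ 2 * 0)).mpr (by
      rw [WeierstrassCurve.Affine.equation_iff, hp, hδ, hε]; linear_combination (-(ϖ ^ 3)) * ht))
  set P₀ : (J.baseChange K).toAffine.Point := .some _ _ hns₀ with hP₀
  have hP₀H : P₀ ∉ H := fun h => not_hasNonsingularReduction_of_X_mem J h3' h4' h6'
    (Ideal.mul_mem_right _ _ hm) hns₀ rfl ((WeierstrassCurve.mem_nonsingularReductionSubgroup_iff _).mp h)
  -- their sum is bad
  have hne : residue R x₁ ≠ residue R t := by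
    rw [(residue_eq_zero_iff _).mpr hx₁, htres, ne_eq, zero_eq_neg]; exact hpres
  have hsumH : P₁ + P₀ ∉ H := fun h =>
    not_hasNonsingularReduction_add_of_residue_ne J hϖ h2 h3' h4' h6' hne hns₁ hns₀
      ((WeierstrassCurve.mem_nonsingularReductionSubgroup_iff _).mp h)
  rcases index_mem_of_normalForm_Istar_succ (K := K) J hΔ h1 h2 h2' h3 h4 h6 with hidx | hidx
  swap
  · exact hidx
  exfalso
  obtain ⟨a, ha⟩ := AddSubgroup.index_eq_two_iff.mp hidx
  have k₁ : P₁ + a ∈ H := (ha P₁).elim (fun h => h.1) fun h => absurd h.1 hP₁H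
  have k₂ : P₁ + P₀ + a ∈ H := (ha (P₁ + P₀)).elim (fun h => h.1) fun h => absurd h.1 hsumH
  have k₃ := H.sub_mem k₂ k₁
  rw [show P₁ + P₀ + a - (P₁ + a) = P₀ by abel] at k₃
  exact hP₀H k₃

/-- **No point of side `D` forces `[E(K) : E₀(K)] = 2`** (normal form of type `Iₙ*`, `n ≥ 1`, `R`
Henselian): every point with singular reduction is `(πx₁, π²y₂)` with `x̄₁²(x̄₁ + p̄) = 0`
(`LocalIndex.exists_root_of_not_hasNonsingularReduction`); with side `D` excluded all have
`x̄₁ = −p̄`, a simple root, so any two add into `E₀(K)`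
(`LocalIndex.hasNonsingularReduction_add_of_same_root`); and `E₀(K) ≠ E(K)` because the index is
`2` or `4`. [cite: Tate1975, §7] [cite: Silverman1994, IV.9.4 Step 7] -/
theorem index_eq_two_of_no_sideD [HenselianLocalRing R] (J : WeierstrassCurve R) (hΔ : J.Δ ≠ 0)
    (h1 : J.a₁ ∈ maximalIdeal R) (h2 : J.a₂ ∈ maximalIdeal R) (h2' : J.a₂ ∉ maximalIdeal R ^ 2)
    (h3 : J.a₃ ∈ maximalIdeal R ^ 2) (h4 : J.a₄ ∈ maximalIdeal R ^ 3)
    (h6 : J.a₆ ∈ maximalIdeal R ^ 4)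
    (hno : ∀ x₁ y₂ : R, x₁ ∈ maximalIdeal R →
      ¬ J.toAffine.Equation (uniformizer R * x₁) (uniformizer R ^ 2 * y₂)) :
    (J.nonsingularReductionSubgroup (integers_valuationRing_valuation R K)).index = 2 := by
  have hϖ : Irreducible (uniformizer R) := irreducible_uniformizer
  set ϖ := uniformizer R with hϖdef
  set H := J.nonsingularReductionSubgroup (integers_valuationRing_valuation R K) with hH
  have hinj := IsFractionRing.injective R K
  have hm : ϖ ∈ maximalIdeal R := (IsLocalRing.mem_maximalIdeal _).mpr hϖ.not_isUnit
  have hres0 : residue R ϖ = 0 := (residue_eq_zero_iff _).mpr hm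
  obtain ⟨α, p, γ, q, w, hα, hp, hpu, hγ, hδ, hε⟩ := normalForm_Istar_params J h1 h2 h2' h3 h4 h6
  rw [← hϖdef] at hα hp hγ hδ hε
  have hpres : residue R p ≠ 0 := (isUnit_iff_residue_ne_zero p).mp hpu
  have hne1 : H.index ≠ 1 := by
    rcases index_mem_of_normalForm_Istar_succ (K := K) J hΔ h1 h2 h2' h3 h4 h6 with h | h <;>
      simp [hH.symm ▸ h]
  have hex : ∃ P₀, P₀ ∉ H := by
    by_contra hall
    simp only [not_exists, not_not] at hall
    exact hne1 (AddSubgroup.index_eq_one.mpr (eq_top_iff.mpr fun P _ => hall P))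
  obtain ⟨P₀, hP₀⟩ := hex
  -- every bad point is of side `S`
  have hside : ∀ (x₁ y₂ : R), (J.baseChange K).toAffine.Nonsingular (algebraMap R K (ϖ * x₁))
      (algebraMap R K (ϖ ^ 2 * y₂)) →
      x₁ ^ 3 + p * x₁ ^ 2 + ϖ * q * x₁ + ϖ * w = ϖ * (y₂ ^ 2 + α * x₁ * y₂ + γ * y₂) →
        residue R x₁ = -residue R p := by
    intro x₁ y₂ h hid
    have := congrArg (residue R) hid
    simp only [map_add, map_mul, map_pow, hres0, zero_mul, add_zero] at this
    have h0 : residue R x₁ ^ 2 * (residue R x₁ + residue R p) = 0 := by linear_combination this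
    rcases mul_eq_zero.mp h0 with h0 | h0
    · exfalso
      refine hno x₁ y₂ ((residue_eq_zero_iff _).mp (pow_eq_zero_iff two_ne_zero |>.mp h0)) ?_
      exact (WeierstrassCurve.Affine.map_equation _ hinj _ _).mp h.left
    · linear_combination h0
  refine index_eq_two_of_forall_add_mem H hP₀ fun P Q hP hQ => ?_
  rw [hH, WeierstrassCurve.mem_nonsingularReductionSubgroup_iff] at hP hQ ⊢
  obtain ⟨x₁, y₂, h, rfl, hid⟩ := exists_root_of_not_hasNonsingularReduction J hϖ hα hp hγ hδ hε hP
  obtain ⟨x₁', y₂', h', rfl, hid'⟩ :=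
    exists_root_of_not_hasNonsingularReduction J hϖ hα hp hγ hδ hε hQ
  have hr := hside x₁ y₂ h hid
  refine hasNonsingularReduction_add_of_same_root J hϖ hα hp hγ hδ hε
    (hr.trans (hside x₁' y₂' h' hid').symm) ?_ h h'
  rw [hr]
  simp only [map_mul, hres0, zero_mul, add_zero]
  have e : 3 * (-residue R p) ^ 2 + 2 * residue R p * -residue R p = residue R p ^ 2 := by ring
  rw [e]
  exact pow_ne_zero 2 hpres

end Local

end Summit.BirchSwinnertonDyer.BirchSwinnertonDyer.Rank2Observatory.Tam

end
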